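import Mathlib
import Summits.PneNP.PneNP.Theorems.ConvexRankGatesConvexGateBlindColumnSpaceQuarter
import Summits.PneNP.PneNP.Theorems.ConvexRankGatesConvexGateBlindRankPlusOneFifth

/-!
# PneNP / ConvexRankGates — `ConvexGateBlind`: rank + 1 and no negative covers for every `δ < 1/4`

Helpers (`--supports stmt-PneNP-10680`), COLUMN-SPACE line (prover seat 2, session 16): the two corollaries of the
column-space theorem, upgraded to `δ < 1/4` (unconditionally) via the third-generation catch bound `…CatchVar.card_badColourings_le_var`
with `L = 2k²−4k+1` (earlier this session: `δ < 1/4`, `…RankPlusOneFifth`).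

* `lpSlice_terms_gt_choose_two_quarter` (stub `lpSlice_rank_plus_one_quarter`) — for every `δ ∈ (0,1/4)`: eventually in `m`,
  for every `ε > 0`, EVERY non-negative factorisation `cdist Q u − ε = ∑_{l<R} U_l(u) V_l(Q)` of the LP slice has
  `R ≥ C(m,2) + 1 = rank + 1` terms; `not_coneFactorisable_le_choose_two_quarter` is the `ConeFactorisable` phrasing.
* `negCoverHard_quarter` (stub `negCover_hard_quarter`) — for every `δ ∈ (0,1/4)` and every `c`: eventually no family of
  `s ≤ m^c` clique-non-negative weightings is a negative cover.
[new]
-/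

set_option linter.dupNamespace false

namespace Summit.PneNP.PneNP.Theorems

open Finset Real Filter Literature.Computability.Complexity
open Summit.PneNP.PneNP.Cruxes.ConvexGateBlind.StrictRankConicCover (Edge cdist)

noncomputable section

/-! ## Rank + 1 -/

/-- **ε-sensitivity costs at least one term, every `δ < 1/4`.** For every `δ ∈ (0, 1/4)`, eventually in `m` (`k = ⌈m^δ⌉₊`),
for every `ε > 0` and every `R ≤ C(m,2)`: there is NO non-negative factorisation `cdist Q u − ε = ∑_{l<R} U_l(u) V_l(Q)`
(`U ≥ 0`, `V_l ≥ 0` on `k`-sets) valid for all `k`-sets `Q` and all `k`-clique-free `u`. [new] -/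
theorem lpSlice_terms_gt_choose_two_quarter {δ : ℝ} (hδ0 : 0 < δ) (hδ1 : δ < 1 / 4) :
    ∀ᶠ m : ℕ in atTop, ∀ ε : ℝ, 0 < ε → ∀ R : ℕ, R ≤ m.choose 2 →
      ∀ (U : (Edge m → Bool) → Fin R → ℝ) (V : Fin R → Finset (Fin m) → ℝ),
      (∀ u l, 0 ≤ U u l) → (∀ l (Q : Finset (Fin m)), Q.card = ⌈(m : ℝ) ^ δ⌉₊ → 0 ≤ V l Q) →
      ¬ ∀ (Q : Finset (Fin m)) (u : Edge m → Bool), Q.card = ⌈(m : ℝ) ^ δ⌉₊ → cliqueFn m ⌈(m : ℝ) ^ δ⌉₊ u = false →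
          cdist Q u - ε = ∑ l, U u l * V l Q := by
  filter_upwards [columnSpace_cliqueDistConeRankHard_quarter hδ0 hδ1 2, eventually_catch_exponent_var hδ0 hδ1 0]
    with m hcol hk
  obtain ⟨hk4, hkm, -, -⟩ := hk
  intro ε hε R hR U V hU hV hall
  have hkm2 : ⌈(m : ℝ) ^ δ⌉₊ + 2 ≤ m := by omega
  choose t ht using fun l => exists_edgeWeighting_of_card_le (by omega) hkm2 ε U V hall hR l
  refine hcol ε hε R (hR.trans (Nat.choose_le_pow m 2)) t U (fun l Q hQ => ?_) hU (fun Q u hQ hu => ?_)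
  · rw [← ht l Q hQ]; exact hV l Q hQ
  · rw [hall Q u hQ hu]
    exact Finset.sum_congr rfl fun l _ => by rw [ht l Q hQ]

/-- **The same in the `ConeFactorisable` vocabulary of the strict-rank line** (`q = 0` PSD part, constant potential
`a ≡ ε`, `b ≡ 1`): for `δ ∈ (0,1/4)`, eventually in `m`, for every `ε > 0` and every `r ≤ C(m,2)`,
`¬ ConeFactorisable m ⌈m^δ⌉₊ 0 r (fun _ => ε) (fun _ => 1)`. [new] -/
theorem not_coneFactorisable_le_choose_two_quarter {δ : ℝ} (hδ0 : 0 < δ) (hδ1 : δ < 1 / 4) :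
    ∀ᶠ m : ℕ in atTop, ∀ ε : ℝ, 0 < ε → ∀ r : ℕ, r ≤ m.choose 2 →
      ¬ Summit.PneNP.PneNP.Cruxes.ConvexGateBlind.StrictRankConicCover.ConeFactorisable m ⌈(m : ℝ) ^ δ⌉₊ 0 r
        (fun _ => ε) (fun _ => 1) := by
  filter_upwards [lpSlice_terms_gt_choose_two_quarter hδ0 hδ1] with m hm
  intro ε hε r hr hcf
  obtain ⟨H, Y, U, V, -, -, hU, hV, hall⟩ := hcf
  refine hm ε hε r hr U V hU (fun l Q _ => hV l Q) fun Q u hQ hu => ?_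
  have h := hall Q u hQ hu
  rw [Matrix.trace, Fintype.sum_empty, zero_add, mul_one] at h
  exact h

/-- **ε-sensitivity costs at least one term, every `δ < 1/4`** (registered form of `lpSlice_terms_gt_choose_two_quarter`).
[new] -/
theorem lpSlice_rank_plus_one_quarter : ∀ (δ : ℝ), 0 < δ → δ < 1 / 4 → ∀ᶠ m : ℕ in Filter.atTop, ∀ ε : ℝ, 0 < ε → ∀ R : ℕ, R ≤ m.choose 2 → ∀ (U : (Edge m → Bool) → Fin R → ℝ) (V : Fin R → Finset (Fin m) → ℝ), (∀ u l, 0 ≤ U u l) → (∀ l (Q : Finset (Fin m)), Q.card = ⌈(m : ℝ) ^ δ⌉₊ → 0 ≤ V l Q) → ¬ ∀ (Q : Finset (Fin m)) (u : Edge m → Bool), Q.card = ⌈(m : ℝ) ^ δ⌉₊ → cliqueFn m ⌈(m : ℝ) ^ δ⌉₊ u = false → cdist Q u - ε = ∑ l, U u l * V l Q :=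
  fun _ hδ0 hδ1 => lpSlice_terms_gt_choose_two_quarter hδ0 hδ1

/-! ## No polynomial negative covers -/

/-- **No polynomial negative covers (every `δ ∈ (0, 1/4)`, every `c`).** Eventually in `m` (`k = ⌈m^δ⌉₊`), for every
`s ≤ m^c`, all `k`-clique-non-negative `t_1,…,t_s` and all `μ ≥ 0`: the family is NOT a negative cover. (Hypotheses `0 ≤ Λ`,
`∑_j μ_j t_j ≤ Λ` kept for comparability with `negCoverHard_of_convexGateBlind`, not used.) [new] -/
theorem negCoverHard_quarter {δ : ℝ} (hδ0 : 0 < δ) (hδ1 : δ < 1 / 4) :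
    ∀ c : ℕ, ∀ᶠ m : ℕ in atTop, ∀ s : ℕ, s ≤ m ^ c →
      ∀ (t : Fin s → Edge m → ℝ) (μ : (Edge m → Bool) → Fin s → ℝ) (Λ : ℝ),
        (∀ j (Q : Finset (Fin m)), Q.card = ⌈(m : ℝ) ^ δ⌉₊ → 0 ≤ ∑ e, if cliqueVec Q e = true then t j e else 0) →
        (∀ u j, 0 ≤ μ u j) → 0 ≤ Λ →
        (∀ u, cliqueFn m ⌈(m : ℝ) ^ δ⌉₊ u = false → ∀ e, ∑ j, μ u j * t j e ≤ Λ) →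
        ¬ ∀ u, cliqueFn m ⌈(m : ℝ) ^ δ⌉₊ u = false → ∀ e, u e = true → ∑ j, μ u j * t j e ≤ -1 := by
  intro c
  filter_upwards [eventually_catch_exponent_var hδ0 hδ1 c] with m hm
  obtain ⟨hk4, hkm, hsq, hsmall⟩ := hm
  intro s hs t μ Λ ht hμ _ _ hcov
  set k : ℕ := ⌈(m : ℝ) ^ δ⌉₊ with hk
  have hkm2 : k + 2 ≤ m := by omega
  have hkR : (4 : ℝ) ≤ k := by exact_mod_cast hk4
  have hL1 : (1 : ℝ) ≤ 2 * (k : ℝ) ^ 2 - 4 * k + 1 := by nlinarith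
  have hLq : (k : ℝ) - 1 ≤ 12 * (2 * (k : ℝ) ^ 2 - 4 * k + 1) := by nlinarith
  set θ : ℝ := Real.exp (-(((k : ℝ) - 1) * ((m : ℝ) - 1) / (2304 * k * (2 * (k : ℝ) ^ 2 - 4 * k + 1) ^ 2))) +
    Real.exp (-(1 / (5200 * Real.sqrt (2 * (k : ℝ) * ((k : ℝ) - 2) / ((m : ℝ) - k - 1))))) with hθ
  have hlb := negCover_size_lower_bound_of_catch (by omega) hkm2 t ht μ hμ hcov θ
    (fun w hw => by
      have h := card_badColourings_le_var hk4 hsq (2 * (k : ℝ) ^ 2 - 4 * k + 1) hL1 hLq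
        (fun v hv => abs_sum_le_of_cliqueNonneg_at hk4 hkm2 v hv) w hw
      rw [hθ, mul_add]
      exact h)
  have hθ0 : 0 < θ := by rw [hθ]; positivity
  have hq3 : (3 : ℝ) ≤ ((k - 1 : ℕ) : ℝ) := by
    have : 3 ≤ k - 1 := by omega
    exact_mod_cast this
  set qm : ℝ := ((k - 1 : ℕ) : ℝ) ^ m with hqm
  have hqm0 : 0 < qm := by rw [hqm]; positivity
  have hq_le : ((k - 1 : ℕ) : ℝ) ≤ qm / 2 := by
    obtain ⟨m', hm'⟩ : ∃ m', m = m' + 2 := ⟨m - 2, by omega⟩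
    rw [hqm, hm', pow_succ, pow_succ]
    have h1 : (1 : ℝ) ≤ ((k - 1 : ℕ) : ℝ) ^ m' := one_le_pow₀ (by linarith)
    have hQ0 : (0 : ℝ) ≤ ((k - 1 : ℕ) : ℝ) := by positivity
    have h2 := mul_le_mul h1 hq3 (by norm_num) (by positivity)
    have h3 := mul_le_mul_of_nonneg_right h2 hQ0
    linarith
  have hsθ : (s : ℝ) * (qm * θ) ≤ qm / 4 := by
    have hs' : (s : ℝ) ≤ (m : ℝ) ^ c := by exact_mod_cast hs
    calc (s : ℝ) * (qm * θ) ≤ (m : ℝ) ^ c * (qm * θ) := mul_le_mul_of_nonneg_right hs' (by positivity)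
      _ = qm * ((m : ℝ) ^ c * θ) := by ring
      _ ≤ qm * (1 / 4) := mul_le_mul_of_nonneg_left hsmall hqm0.le
      _ = qm / 4 := by ring
  linarith

/-- **No polynomial negative covers, every `δ < 1/4`** (registered form of `negCoverHard_quarter`). [new] -/
theorem negCover_hard_quarter : ∀ (δ : ℝ), 0 < δ → δ < 1 / 4 → ∀ c : ℕ, ∀ᶠ m : ℕ in Filter.atTop, ∀ s : ℕ, s ≤ m ^ c → ∀ (t : Fin s → Edge m → ℝ) (μ : (Edge m → Bool) → Fin s → ℝ) (Λ : ℝ), (∀ j (Q : Finset (Fin m)), Q.card = ⌈(m : ℝ) ^ δ⌉₊ → 0 ≤ ∑ e, if cliqueVec Q e = true then t j e else 0) → (∀ u j, 0 ≤ μ u j) → 0 ≤ Λ → (∀ u, cliqueFn m ⌈(m : ℝ) ^ δ⌉₊ u = false → ∀ e, ∑ j, μ u j * t j e ≤ Λ) → ¬ ∀ u, cliqueFn m ⌈(m : ℝ) ^ δ⌉₊ u = false → ∀ e, u e = true → ∑ j, μ u j * t j e ≤ -1 :=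
  fun _ hδ0 hδ1 c => negCoverHard_quarter hδ0 hδ1 c

end

end Summit.PneNP.PneNP.Theorems
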